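import Summits.QuantumFields.YangMills.Theorems.BalabanUVNodesN15GenuineUnitKernelRate
import Summits.QuantumFields.YangMills.Theorems.BalabanUVNodesN15TwoGridReadoutFull
import Summits.QuantumFields.YangMills.Theorems.BalabanUVNodesN15AtKeyedHome

/-!
# Route «BalabanUVNodes», cluster K4 «SpineRates» — node N15 = NE2: `N15At` — ALL THREE CONJUNCTS, NO DISPLAYED BINDER — FOR BAŁABAN's GENUINE `U ≡ 1` OBJECTS ON THE
# TORUS FAMILY OF RECORD, THE `NE2Objects₁₁` LITERAL OF THAT FAMILY, AND ITS KEYED-HOME FACE (any rate home admitting the literals has `S_N15` with no estimate displayed)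

Cell `pub-ymgap`, seat `pub-ymgap-dag-n15-a` (-a KNIT-BY-NAME seat of node N15; HUMAN RULING D-0062; chair R424 venue), generation 14, part 73 (one data `def`, the
rest theorems; 0 `sorry`).  `bears_on: R4∕N15 · K3⁷ SpineGivenEndpointR13SepCoPH (stmt-QuantumFields-20544, plan rev 24∕25; dag-lead WORDS-143: spine ∕ NE ∕ rates → 20544)`.
Filed `--kind proof --supports stmt-QuantumFields-20544 --as helper` — COUNT-NEUTRAL.

WHY.  dag-n15-c g7's module G3 `…N15GenuineUnitKernelRate` (p532942) proved `n15At_fullG_genuine_of_entry2`: `YMDAG.UVSplit.N15At` for the record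
`⟨TGIndex, c₃₅, p, tgInstance, tgFamily b (entry1Op b ν) T2, genuineSiteStep a_S, genuineUnitKernel b a, ⊤, dist⟩` — OPERATOR layer = this seat's door-(iv) pair
`(G′, G) = (Δ′_b⁻¹, Δ_b⁻¹)` (Bałaban's full Landau-gauge propagator [B5] (1.69)–(1.71) at `U ≡ 1` on both grids, King's prolongation), SITE layer = [B4-I]∕[B5]'s
`(Q′G′²Q′*)⁻¹` (G1 `ne2PlusSite_genuineSite`), UNIT layer = King's covariance `(a·1 − a²QGQ*)⁻¹` of `Δ_b⁻¹` (G3 `ne2PlusUnit_genuineKingForm`, weight window) — with ONE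
displayed binder, the entry-2 operator `T2 = 𝔇(G∇_μ*)` and its uniform majorant.  This seat's g13 part 71 `hasMaj_twoGridDefect_div` (p544964) and part 72
`hasMaj_tgT2` (p545729) supply exactly that majorant, hypothesis-free.  This file composes the two (dag-n15-c g7 HANDOFF trigger (t1)∕(G6), offered to either seat):
§1 ★★★ `n15At_fullG_genuine` — `N15At` with NO displayed binder for the genuine family `tgFamily b (tgT1 b ν) (tgT2 b μ)` (= part 72's family; `entry1Op b (fun _ => ν)`
IS `tgT1 b ν` by `rfl`); §2 the family as ONE `Node00.NE2Objects₁₁` literal `fullGObjects d hL b a_S a ν μ c₃₅ p` (RR-1's layer-A container for N15's objects), its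
`N15At` (`n15At_fullGObjects`), its populatedness (`populated_fullGObjects`, RR-1 §8 display: `TGIndex` is inhabited); §3 the KEYED-HOME FACE in the stage-generic
interface of part 30 `…N15AtKeyedHome`: a rate home over ANY key that admits only the literals of a reading valued in `fullGObjects …` (weight in the window) has
`S_N15 RRec` — `s_N15_of_admits_fullG` (one block factor `L`) and `s_N15_of_admits_fullG_family` (the reading reads the datum's OWN family: block factor `F.L`, parity∕size
`F.hL : Odd F.L ∧ 1 < F.L` — Bałaban's structural hypothesis IS the torus family's —, `2 ≤ F.L` from `11 < L`; `d + 1 = 4`).  The Stage-13 v1.7 `CoPH` homes instantiate §3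
in the companion parts 74∕75 (`…N15AtRRec13CoPH`, `…N15AtReadingOfRecord13CoPH`).

HONEST FRAMING.  Kernel bookkeeping BY NAME over landed theorems (dag-n15-c G1∕G3, this seat's parts 52∕54∕59∕71∕72); no new estimate.  WHAT THE FAMILY IS: the `U ≡ 1`
(A = 0) content of node N15 for Bałaban's OWN linear objects on the torus family of record `M_μ = 2L^{m_T}`, `n = L^k`, `n′ = L^m·L^k` — one-point background carrier, so the
regularity condition (3.35)∕(3.36) is VOID and the «+» blocks are inert (NE2⁰ content inside NE2⁺'s type); the unit layer needs King's weight `a` in a Neumann window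
`0 < |a| ≤ a₀(d, L, b)`; rates `(L^k)^{−1∕16}`, `(L^k)^{−1∕(8(d+1))}`, `L^{−k∕4}` are sup-block-currency artefacts.  WHAT IT IS NOT: NOT Bałaban's multiscale `G(U)` with the
background LIVE (NE2⁺ proper — NOT PRINTED beyond King's scalar template [King1986] Lemma 4.5 (4.38) p.674 — is untouched), NOT Node 00's [B9] operator layer of record
(residual), so **N15 is NOT discharged** (typed 28∕28 · discharged 5∕27 of record unchanged); count-neutral; one finite four-torus programme at fixed `ε` — NOT ℝ⁴, NOT
infinite volume, NOT OS, NOT a mass gap, NOT Clay.  Restate-immune (no Theses import).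
-/

set_option autoImplicit false

noncomputable section
namespace Summit.QuantumFields.YangMills.BalabanUVNodes.N15.GenuineRecord

open Literature.MathematicalPhysics.QuantumFieldTheory.Balaban1983to89
open Literature.MathematicalPhysics.QuantumFieldTheory.Balaban1983to89.T4Continuum (T4Family ULoop)
open Literature.MathematicalPhysics.QuantumFieldTheory.Balaban1983to89.T4EtaRate (PairedInstance NE2PlusOperator NE2PlusSite NE2PlusUnit)
open Node00 (NE2Objects₁₁)
open Summit.QuantumFields.BalabanUV.T4Continuum.HistoryFlow (two_le_L)
open Summit.QuantumFields.YangMills.BalabanUVNodes.N15.TwoGrid (TGIndex tgInstance tgGeoC tgFamily tgT1 tgT2 hasMaj_tgT2 tgIndex_nonempty)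
open Summit.QuantumFields.YangMills.BalabanUVNodes.N15.GenuineSite (genuineSiteStep genuineUnitKernel n15At_fullG_genuine_of_entry2)
open Summit.QuantumFields.YangMills.BalabanUVNodes.N15.AtKeyedHome (s_N15_of_admits neZero_blockFactor)
open YMDAG.UVSplit (Datum NE2Carriers RateCarriers RateRecordPred N15At S_N15 ne2OfRecord₁₁)

variable {d : ℕ} {L : ℕ} [NeZero L]

/-! ## §1 `N15At` for the genuine `U ≡ 1` family — no displayed binder -/

/-- ★★★ **`N15At` — ALL THREE CONJUNCTS BY NAME, NO DISPLAYED BINDER — FOR BAŁABAN's GENUINE `U ≡ 1` OBJECTS ON THE TORUS FAMILY OF RECORD.**  For odd `L ≥ 3`,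
couplings `b, a_S > 0` and directions `ν, μ` (entry 1's gradient ∕ entry 2's divergence direction) there is a weight window `a₀ > 0` such that for every `a ≠ 0`,
`|a| ≤ a₀`, every `c₃₅` and `p`: `N15At ⟨TGIndex, c₃₅, p, tgInstance, tgFamily b (tgT1 b ν) (tgT2 b μ), genuineSiteStep a_S, genuineUnitKernel b a, ⊤, dist⟩` —
OPERATOR = part 72 `ne2PlusOperator_fullG` (all four (3.42) entries of `(Δ′_b⁻¹, Δ_b⁻¹)`), SITE = dag-n15-c G1 `ne2PlusSite_genuineSite`, UNIT = dag-n15-c G3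
`ne2PlusUnit_genuineKingForm`; = G3 §4 `n15At_fullG_genuine_of_entry2` at `T2 := tgT2 b μ` with part 72's `hasMaj_tgT2` (`entry1Op b (fun _ => ν) = tgT1 b ν` by `rfl`).
One-point background carrier: the «+» blocks are inert (content NE2⁰'s) — said. [bookkeeping] -/
theorem n15At_fullG_genuine (hLodd : Odd L) (hL2 : 2 ≤ L) (hL : Odd L ∧ 1 < L) {b aS : ℝ} (hb : 0 < b) (haS : 0 < aS) (ν μ : Fin (d + 1)) :
    ∃ a₀ : ℝ, 0 < a₀ ∧ ∀ a : ℝ, a ≠ 0 → |a| ≤ a₀ → ∀ c35 p : ℝ,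
      N15At { I := TGIndex, c35 := c35, p := p, pi := tgInstance d hL, Kop := tgFamily d hL b (tgT1 d hL b ν) (tgT2 d hL b μ), Ksite := genuineSiteStep d hL aS,
              Kunit := genuineUnitKernel d hL b a, inΛ := fun _ _ => True, unitDist := fun i => (tgGeoC d hL i).dist } := by
  obtain ⟨δ₂, C₂, hδ₂, hC₂, H2⟩ := hasMaj_tgT2 (d := d) hLodd hL2 hL hb μ
  exact n15At_fullG_genuine_of_entry2 d hLodd hL2 hL hb haS (fun _ => ν) (tgT2 d hL b μ) (by positivity) hδ₂ H2

/-! ## §2 The genuine family as N15's `NE2Objects₁₁` literal -/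

/-- **N15's NE2 OBJECTS OF THE GENUINE `U ≡ 1` FAMILY** (RR-1's layer-A container `Node00.NE2Objects₁₁`): index `TGIndex` (torus exponent `m_T`, `k ≥ 1`, scale shift
`m`), letters `c₃₅`, `p`, the realised paired instances `tgInstance d hL` (coarse∕fine unit-torus carriers `M_μ = 2L^{m_T}`, King's pairing), OPERATOR kernels
`tgFamily b (tgT1 b ν) (tgT2 b μ)` (the four (3.42) entries of `(Δ′_b⁻¹, Δ_b⁻¹)`), SITE kernel `genuineSiteStep a_S` (`𝔇((Q′G′²Q′*)⁻¹)` at King's couplings on `a_S`),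
UNIT kernel `genuineUnitKernel b a` (`𝔇` of King's covariance of `Δ_b⁻¹` at weight `a`), region `⊤`, unit distance = the carrier's. [bookkeeping] -/
def fullGObjects (d : ℕ) (hL : Odd L ∧ 1 < L) (b aS a : ℝ) (ν μ : Fin (d + 1)) (c35 p : ℝ) : NE2Objects₁₁ where
  I := TGIndex
  c35 := c35
  p := p
  pi := tgInstance d hL
  Kop := tgFamily d hL b (tgT1 d hL b ν) (tgT2 d hL b μ)
  Ksite := genuineSiteStep d hL aS
  Kunit := genuineUnitKernel d hL b a
  inΛ := fun _ _ => True
  unitDist := fun i => (tgGeoC d hL i).dist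

/-- The home's NE2 bundle of the genuine objects IS §1's record (`rfl`, field for field). [bookkeeping] -/
theorem ne2OfRecord₁₁_fullGObjects (hL : Odd L ∧ 1 < L) (b aS a : ℝ) (ν μ : Fin (d + 1)) (c35 p : ℝ) :
    ne2OfRecord₁₁ (fullGObjects d hL b aS a ν μ c35 p) =
      { I := TGIndex, c35 := c35, p := p, pi := tgInstance d hL, Kop := tgFamily d hL b (tgT1 d hL b ν) (tgT2 d hL b μ), Ksite := genuineSiteStep d hL aS,
        Kunit := genuineUnitKernel d hL b a, inΛ := fun _ _ => True, unitDist := fun i => (tgGeoC d hL i).dist } := rfl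

/-- ★★★ **`N15At` AT THE GENUINE OBJECTS' BUNDLE, IN THE WEIGHT WINDOW** (§1 read through `ne2OfRecord₁₁`). [bookkeeping] -/
theorem n15At_fullGObjects (hLodd : Odd L) (hL2 : 2 ≤ L) (hL : Odd L ∧ 1 < L) {b aS : ℝ} (hb : 0 < b) (haS : 0 < aS) (ν μ : Fin (d + 1)) :
    ∃ a₀ : ℝ, 0 < a₀ ∧ ∀ a : ℝ, a ≠ 0 → |a| ≤ a₀ → ∀ c35 p : ℝ, N15At (ne2OfRecord₁₁ (fullGObjects d hL b aS a ν μ c35 p)) :=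
  n15At_fullG_genuine (d := d) hLodd hL2 hL hb haS ν μ

/-- **THE THREE LAYERS SPELLED OUT at the genuine objects** (`N15At` unfolded: `NE2PlusOperator ∧ NE2PlusSite 4 ∧ NE2PlusUnit`). [bookkeeping] -/
theorem layers_fullGObjects (hLodd : Odd L) (hL2 : 2 ≤ L) (hL : Odd L ∧ 1 < L) {b aS : ℝ} (hb : 0 < b) (haS : 0 < aS) (ν μ : Fin (d + 1)) :
    ∃ a₀ : ℝ, 0 < a₀ ∧ ∀ a : ℝ, a ≠ 0 → |a| ≤ a₀ → ∀ c35 p : ℝ,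
      NE2PlusOperator c35 (tgInstance d hL) (tgFamily d hL b (tgT1 d hL b ν) (tgT2 d hL b μ)) ∧
      NE2PlusSite 4 p c35 (tgInstance d hL) (genuineSiteStep d hL aS) ∧
      NE2PlusUnit c35 (tgInstance d hL) (genuineUnitKernel d hL b a) (fun _ _ => True) (fun i => (tgGeoC d hL i).dist) :=
  n15At_fullG_genuine (d := d) hLodd hL2 hL hb haS ν μ

/-- **RR-1's DISPLAY HOLDS AT THE GENUINE LITERAL**: the objects are `Populated` (`TGIndex` carries `⟨0, 1, _, 0⟩`). [bookkeeping] -/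
theorem populated_fullGObjects (hL : Odd L ∧ 1 < L) (b aS a : ℝ) (ν μ : Fin (d + 1)) (c35 p : ℝ) :
    (fullGObjects d hL b aS a ν μ c35 p).Populated :=
  (NE2Objects₁₁.populated_iff _).2 tgIndex_nonempty

/-- **THE WEIGHT WINDOW IS INHABITED**: with `a := a₀` itself (`a₀ ≠ 0`, `|a₀| ≤ a₀`) the genuine objects carry `N15At` at every `c₃₅`, `p` — an outright, parameter-free
instance per `(d, L, b, a_S, ν, μ)`. [bookkeeping] -/
theorem exists_weight_n15At_fullGObjects (hLodd : Odd L) (hL2 : 2 ≤ L) (hL : Odd L ∧ 1 < L) {b aS : ℝ} (hb : 0 < b) (haS : 0 < aS) (ν μ : Fin (d + 1)) :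
    ∃ a : ℝ, 0 < a ∧ ∀ c35 p : ℝ, N15At (ne2OfRecord₁₁ (fullGObjects d hL b aS a ν μ c35 p)) := by
  obtain ⟨a₀, ha₀, H⟩ := n15At_fullGObjects (d := d) hLodd hL2 hL hb haS ν μ
  exact ⟨a₀, ha₀, H a₀ ha₀.ne' (abs_of_pos ha₀).le⟩

/-! ## §3 The keyed-home face: a home admitting the genuine literals has `S_N15`, no estimate displayed -/

section KeyedHome

variable {N : ℕ} [NeZero N] {key : (F : T4Family) → Datum F N → Prop}

/-- ★★ **THE GENUINE READING CLOSES THE STUB AT ANY KEYED HOME** (part 30's interface): for odd `L ≥ 3`, `b, a_S > 0`, directions `ν, μ` there is `a₀ > 0` such that for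
every weight `a ≠ 0`, `|a| ≤ a₀` and letters `c₃₅`, `p`: a rate home `RRec` over ANY key that admits only the literals of a key-indexed NE2 reading `ne2At` (`hadm`)
whose value at every key, `(g₀, os)` and run length IS `fullGObjects d hL b a_S a ν μ c₃₅ p` has `S_N15 RRec` — the estimate is §1, not a hypothesis.  Honest scope:
the `U ≡ 1` objects of the torus family of record (one-point background), NOT Bałaban's `G(U)`. [bookkeeping] -/
theorem s_N15_of_admits_fullG (hLodd : Odd L) (hL2 : 2 ≤ L) (hL : Odd L ∧ 1 < L) {b aS : ℝ} (hb : 0 < b) (haS : 0 < aS) (ν μ : Fin (d + 1)) :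
    ∃ a₀ : ℝ, 0 < a₀ ∧ ∀ a : ℝ, a ≠ 0 → |a| ≤ a₀ → ∀ (c35 p : ℝ)
      (ne2At : ∀ {F : T4Family} {D : Datum F N}, key F D → (ℕ → ℝ) → List (ULoop F) → ℕ → NE2Objects₁₁) (RRec : RateRecordPred N),
      (∀ (F : T4Family) (D : Datum F N) (g₀ : ℕ → ℝ) (os : List (ULoop F)) (R : RateCarriers N), RRec F D g₀ os R →
        ∃ (h : key F D) (k : ℕ), R.ne2 = ne2OfRecord₁₁ (ne2At h g₀ os k)) →
      (∀ (F : T4Family) (D : Datum F N) (h : key F D) (g₀ : ℕ → ℝ) (os : List (ULoop F)) (k : ℕ), ne2At h g₀ os k = fullGObjects d hL b aS a ν μ c35 p) →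
      S_N15 RRec := by
  obtain ⟨a₀, ha₀, H⟩ := n15At_fullGObjects (d := d) hLodd hL2 hL hb haS ν μ
  refine ⟨a₀, ha₀, fun a ha haa c35 p ne2At RRec hadm h => s_N15_of_admits ne2At RRec hadm fun F D hk g₀ os k => ?_⟩
  rw [h F D hk g₀ os k]
  exact H a ha haa c35 p

/-- ★★ **THE FAMILY-KEYED GENUINE READING CLOSES THE STUB AT ANY KEYED HOME** (`d + 1 = 4`): the reading READS THE DATUM's FAMILY — at a key of family `F` its NE2
objects are the genuine objects on `F`'s OWN block factor (`tgInstance 3 F.hL`: Bałaban's structural hypothesis `Odd L ∧ 1 < L` IS the family's field `F.hL`; `2 ≤ F.L`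
from `11 < L`), at a family-dependent weight `a F` inside the window `a₀ F`.  For `b, a_S > 0`, `ν, μ`: there is a window `a₀ : T4Family → ℝ`, positive, such that every
such reading's home has `S_N15 RRec` — no estimate displayed. [bookkeeping] -/
theorem s_N15_of_admits_fullG_family {b aS : ℝ} (hb : 0 < b) (haS : 0 < aS) (ν μ : Fin 4) :
    ∃ a₀ : T4Family → ℝ, (∀ F, 0 < a₀ F) ∧ ∀ a : T4Family → ℝ, (∀ F, a F ≠ 0 ∧ |a F| ≤ a₀ F) → ∀ (c35 p : ℝ)
      (ne2At : ∀ {F : T4Family} {D : Datum F N}, key F D → (ℕ → ℝ) → List (ULoop F) → ℕ → NE2Objects₁₁) (RRec : RateRecordPred N),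
      (∀ (F : T4Family) (D : Datum F N) (g₀ : ℕ → ℝ) (os : List (ULoop F)) (R : RateCarriers N), RRec F D g₀ os R →
        ∃ (h : key F D) (k : ℕ), R.ne2 = ne2OfRecord₁₁ (ne2At h g₀ os k)) →
      (∀ (F : T4Family) (D : Datum F N) (h : key F D) (g₀ : ℕ → ℝ) (os : List (ULoop F)) (k : ℕ),
        ne2At h g₀ os k = haveI := neZero_blockFactor F; fullGObjects 3 F.hL b aS (a F) ν μ c35 p) →
      S_N15 RRec := by
  have H : ∀ F : T4Family, haveI := neZero_blockFactor F;
      ∃ a₀ : ℝ, 0 < a₀ ∧ ∀ a : ℝ, a ≠ 0 → |a| ≤ a₀ → ∀ c35 p : ℝ, N15At (ne2OfRecord₁₁ (fullGObjects 3 F.hL b aS a ν μ c35 p)) := fun F => by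
    haveI := neZero_blockFactor F
    exact n15At_fullGObjects (d := 3) F.hL.1 (two_le_L F) F.hL hb haS ν μ
  choose a₀ ha₀ Ha using H
  refine ⟨a₀, ha₀, fun a ha c35 p ne2At RRec hadm h => s_N15_of_admits ne2At RRec hadm fun F D hk g₀ os k => ?_⟩
  rw [h F D hk g₀ os k]
  exact Ha F (a F) (ha F).1 (ha F).2 c35 p

/-- **RR-1's DISPLAY AT THE FAMILY-KEYED GENUINE LITERAL** (populated at every family). [bookkeeping] -/
theorem populated_fullGObjects_family (F : T4Family) (b aS a : ℝ) (ν μ : Fin 4) (c35 p : ℝ) :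
    (haveI := neZero_blockFactor F; fullGObjects 3 F.hL b aS a ν μ c35 p).Populated := by
  haveI := neZero_blockFactor F
  exact populated_fullGObjects F.hL b aS a ν μ c35 p

end KeyedHome

end Summit.QuantumFields.YangMills.BalabanUVNodes.N15.GenuineRecord

end
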